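import Literature.Probability.Percolation.TriTileBoundary
import Literature.Probability.Percolation.TriSepEscape
import HarnessLib

/-!
# Fans of faces at a site of a union of tiles: the faces of the domain are dually connected

Topic `Literature/Probability/Percolation`; family `crit-perc`. The triangles ("faces") of a discrete
domain whose site set is a union of tiles (`tileUnion`, the tree's "hexagon of hexagons",
Bollobás–Riordan, *Percolation* (2006), Ch. 7 p. 195) hang together across common sides: the
combinatorial input for transporting winding numbers through the domain in the proof of Lemma 14
(p. 184), and for the dual paths of Claim 21 (p. 193, "`P' ∈ δH` … all of whose vertices are the
centres of triangles in `G_δ⁻`"). Chains of faces are `PathIn hexGraph ↑(triFacesIn G)` (the tree's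
notions: `triFacesIn`, `PathIn`).

* `pathIn_triFacesIn_leftFaceDir_of_block` — the faces of `G` at a site whose neighbours in `G` form
  a block of consecutive directions are chained through faces at that site;
* `exists_mem_triFacesIn_of_adj` — two adjacent sites of a union of tiles lie on a common face of it
  (the block of neighbours in the union has size `≥ 3`, `TriTileBoundary.lean`);
* **`pathIn_triFacesIn_tileUnion`** — for a union of tiles over a connected coarse set, any two
  faces of the union are joined by a chain of faces of the union, consecutive ones sharing a side.

## References

* B. Bollobás, O. Riordan, *Percolation*, Cambridge University Press (2006), Ch. 7 §7.2.5
  pp. 193–195, §7.2.6 p. 198.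

## Mathlib / tree

Mathlib: `Relation.ReflTransGen`. Tree: `TriDiscreteDomain.lean` (`triFacesIn`, `mem_triFacesIn`),
`TriDiscShelling.lean` (`leftFaceDir`, `hexFaceVertices_leftFaceDir`), `TriSepEscape.lean`
(`exists_eq_leftFaceDir_of_mem`: every face containing `u` is one of the six faces `leftFaceDir u j`;
`hexGraph_adj_leftFaceDir_succ`, `fin6_ofNat_succ`, `fin6_ofNat_val`),
`TriTileDomain.lean` (`pathIn_tileUnion`, `oneBlockAt_tileUnion`), `TriTileBoundary.lean`
(`three_le_card_filter_add_triDir_mem_tileUnion`), `SitePaths.lean` (`PathIn` and its API).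
-/

noncomputable section

open Finset Literature.Probability.LatticeModels

namespace Literature.Probability.Percolation

open RemovableAt (val_ofNat_of_le fin6_five_add_one exists_offset hexFaceVertices_leftFaceDir leftFaceDir_injective)

/-! ### The faces at a site -/

/-- The face between the directions `j` and `j + 1` at `u` is a face of `G` iff `u` and the two
neighbours are in `G`. [folklore] -/
theorem leftFaceDir_mem_triFacesIn_iff {G : Finset (Site 2)} {u : Site 2} {j : Fin 6} :
    leftFaceDir u j ∈ triFacesIn G ↔ u ∈ G ∧ u + triDir j ∈ G ∧ u + triDir (j + 1) ∈ G := by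
  rw [mem_triFacesIn, hexFaceVertices_leftFaceDir]
  simp only [insert_subset_iff, singleton_subset_iff]

/-- **Consecutive faces at a site are chained** when the intermediate neighbours are in `G`: the
faces `leftFaceDir u (a + s)` and `leftFaceDir u (a + t)`, `s ≤ t`, are joined through the faces
`leftFaceDir u (a + r)`, `s ≤ r ≤ t`, provided `u` and the neighbours `u + e_{a+r}`, `s ≤ r ≤ t + 1`,
lie in `G` (offsets read in `Fin 6`). [folklore] -/
theorem pathIn_triFacesIn_leftFaceDir_of_block {G : Finset (Site 2)} {u : Site 2} (hu : u ∈ G) (a : Fin 6) {s t : ℕ}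
    (hst : s ≤ t) (hin : ∀ r : ℕ, s ≤ r → r ≤ t + 1 → u + triDir (a + Fin.ofNat 6 r) ∈ G) :
    PathIn hexGraph (↑(triFacesIn G) : Set HexVertex) (leftFaceDir u (a + Fin.ofNat 6 s)) (leftFaceDir u (a + Fin.ofNat 6 t)) := by
  induction t, hst using Nat.le_induction with
  | base =>
    refine PathIn.refl (Finset.mem_coe.2 (leftFaceDir_mem_triFacesIn_iff.2 ⟨hu, hin s le_rfl (by omega), ?_⟩))
    rw [add_assoc, ← fin6_ofNat_succ]; exact hin (s + 1) (by omega) le_rfl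
  | succ t hst ih =>
    have ih' := ih (fun r hr hr' => hin r hr (by omega))
    refine ih'.tail ?_ (Finset.mem_coe.2 ?_)
    · rw [fin6_ofNat_succ, ← add_assoc]; exact hexGraph_adj_leftFaceDir_succ u _
    · rw [leftFaceDir_mem_triFacesIn_iff]
      refine ⟨hu, hin (t + 1) (by omega) (by omega), ?_⟩
      rw [add_assoc, ← fin6_ofNat_succ]; exact hin (t + 2) (by omega) (by omega)

/-- **The faces of a union of tiles at one of its sites are chained through faces at that site.** [folklore] -/
theorem pathIn_triFacesIn_of_mem_of_mem {S' : Finset (Site 2)} {u : Site 2} (hu : u ∈ tileUnion S') {F F' : HexVertex}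
    (hF : F ∈ triFacesIn (tileUnion S')) (hF' : F' ∈ triFacesIn (tileUnion S')) (huF : u ∈ hexFaceVertices F)
    (huF' : u ∈ hexFaceVertices F') : PathIn hexGraph (↑(triFacesIn (tileUnion S')) : Set HexVertex) F F' := by
  obtain ⟨j, rfl⟩ := exists_eq_leftFaceDir_of_mem huF
  obtain ⟨j', rfl⟩ := exists_eq_leftFaceDir_of_mem huF'
  rw [leftFaceDir_mem_triFacesIn_iff] at hF hF'
  rcases oneBlockAt_tileUnion S' u with hall | hnone | ⟨a, m, hm1, hblk⟩
  · -- all six neighbours inside: go around from `j` to `j'` through offsets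
    obtain ⟨t, rfl⟩ := exists_offset j j'
    have key := pathIn_triFacesIn_leftFaceDir_of_block (G := tileUnion S') hu j (s := 0) (t := t.val) (Nat.zero_le _)
      (fun r _ _ => hall _)
    rw [fin6_ofNat_val] at key
    simpa using key
  · exact absurd hF.2.1 (hnone j)
  · -- a block `a, …, a + m - 1` of inside neighbours: `j = a + s`, `j' = a + s'` with `s + 1, s' + 1 < m`
    obtain ⟨s, rfl⟩ := exists_offset a j
    obtain ⟨s', rfl⟩ := exists_offset a j'
    have hs : s.val < m.val := (hblk s).1 hF.2.1
    have hs1 : (s + 1).val < m.val := (hblk (s + 1)).1 (by rw [← add_assoc]; exact hF.2.2)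
    have hs' : s'.val < m.val := (hblk s').1 hF'.2.1
    have hs'1 : (s' + 1).val < m.val := (hblk (s' + 1)).1 (by rw [← add_assoc]; exact hF'.2.2)
    have hm6 := m.isLt
    -- no wrap-around
    have hsv : (s + 1).val = s.val + 1 := by
      rw [Fin.val_add_one]; split_ifs with h5
      · rw [h5] at hs; simp at hs; omega
      · rfl
    have hs'v : (s' + 1).val = s'.val + 1 := by
      rw [Fin.val_add_one]; split_ifs with h5
      · rw [h5] at hs'; simp at hs'; omega
      · rfl
    have hin : ∀ r : ℕ, r + 1 < m.val + 1 → u + triDir (a + Fin.ofNat 6 r) ∈ tileUnion S' := by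
      intro r hr
      refine (hblk (Fin.ofNat 6 r)).2 ?_
      rw [Fin.val_ofNat, Nat.mod_eq_of_lt (by omega)]; omega
    rcases le_total s.val s'.val with hle | hle
    · have key := pathIn_triFacesIn_leftFaceDir_of_block (G := tileUnion S') hu a hle
        (fun r _ hr' => hin r (by omega))
      rw [fin6_ofNat_val, fin6_ofNat_val] at key
      exact key
    · have key := pathIn_triFacesIn_leftFaceDir_of_block (G := tileUnion S') hu a hle
        (fun r _ hr' => hin r (by omega))
      rw [fin6_ofNat_val, fin6_ofNat_val] at key
      exact key.symm

/-! ### Adjacent sites of a union of tiles share a face -/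

/-- **Two adjacent sites of a union of tiles lie on a common face of the union**: the block of
neighbours of `u` in the union has size `≥ 3` and contains `v`, hence a rotational neighbour of `v`. [folklore] -/
theorem exists_mem_triFacesIn_of_adj {S' : Finset (Site 2)} {u v : Site 2} (hu : u ∈ tileUnion S') (hv : v ∈ tileUnion S')
    (hadj : triGraph.Adj u v) :
    ∃ F : HexVertex, F ∈ triFacesIn (tileUnion S') ∧ u ∈ hexFaceVertices F ∧ v ∈ hexFaceVertices F := by
  obtain ⟨j, rfl⟩ := (triGraph_adj_iff_triDir u v).1 hadj
  -- one of the two rotational neighbours `u + e_{j±1}` is in the union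
  have key : u + triDir (j + 1) ∈ tileUnion S' ∨ u + triDir (j + 5) ∈ tileUnion S' := by
    rcases oneBlockAt_tileUnion S' u with hall | hnone | ⟨a, m, hm1, hblk⟩
    · exact Or.inl (hall _)
    · exact absurd hv (hnone j)
    · have h3 := three_le_card_filter_add_triDir_mem_tileUnion hu
      -- the block has size `m ≥ 2`
      have hm2 : 2 ≤ m.val := by
        by_contra hlt
        push Not at hlt
        have hsub : (univ.filter fun i : Fin 6 => u + triDir i ∈ tileUnion S') ⊆ {a} := by
          intro i hi
          rw [mem_filter] at hi
          obtain ⟨t, rfl⟩ := exists_offset a i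
          have := (hblk t).1 hi.2
          have ht0 : t = 0 := Fin.ext (by simp; omega)
          rw [ht0, add_zero]; exact mem_singleton_self _
        have := card_le_card hsub
        rw [card_singleton] at this
        omega
      obtain ⟨t, rfl⟩ := exists_offset a j
      have ht : t.val < m.val := (hblk t).1 hv
      by_cases ht1 : t.val + 1 < m.val
      · left
        rw [add_assoc]
        refine (hblk (t + 1)).2 ?_
        rw [Fin.val_add_one]; split_ifs with h5
        · rw [h5] at ht1; simp at ht1; omega
        · exact ht1
      · right
        rw [add_assoc]
        refine (hblk (t + 5)).2 ?_
        have htpos : 1 ≤ t.val := by omega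
        have : (t + 5).val = t.val - 1 := by
          rw [Fin.val_add]; simp; omega
        rw [this]; omega
  rcases key with h1 | h5
  · refine ⟨leftFaceDir u j, leftFaceDir_mem_triFacesIn_iff.2 ⟨hu, hv, h1⟩, ?_, ?_⟩ <;>
      simp [hexFaceVertices_leftFaceDir]
  · refine ⟨leftFaceDir u (j + 5), leftFaceDir_mem_triFacesIn_iff.2 ⟨hu, h5, ?_⟩, ?_, ?_⟩
    · rw [add_assoc, show (5 : Fin 6) + 1 = 0 by decide, add_zero]; exact hv
    · simp [hexFaceVertices_leftFaceDir]
    · rw [hexFaceVertices_leftFaceDir, add_assoc, show (5 : Fin 6) + 1 = 0 by decide, add_zero]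
      simp

/-! ### The faces of a union of tiles are dually connected -/

/-- A face of the union containing a given site of a walk inside the union is chained to a face at
the end of the walk. [folklore] -/
theorem pathIn_triFacesIn_along {S' : Finset (Site 2)} {u v : Site 2}
    (hR : Relation.ReflTransGen (fun a b => triGraph.Adj a b ∧ b ∈ (↑(tileUnion S') : Set (Site 2))) u v)
    {F : HexVertex} (hF : F ∈ triFacesIn (tileUnion S')) (huF : u ∈ hexFaceVertices F) :
    ∃ F' : HexVertex, F' ∈ triFacesIn (tileUnion S') ∧ v ∈ hexFaceVertices F' ∧
      PathIn hexGraph (↑(triFacesIn (tileUnion S')) : Set HexVertex) F F' := by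
  induction hR with
  | refl => exact ⟨F, hF, huF, PathIn.refl (Finset.mem_coe.2 hF)⟩
  | @tail b c _ hbc ih =>
    obtain ⟨F₁, hF₁, hbF₁, hch⟩ := ih
    have hb : b ∈ tileUnion S' := mem_triFacesIn.1 hF₁ hbF₁
    have hc : c ∈ tileUnion S' := Finset.mem_coe.1 hbc.2
    obtain ⟨F₂, hF₂, hbF₂, hcF₂⟩ := exists_mem_triFacesIn_of_adj hb hc hbc.1
    exact ⟨F₂, hF₂, hcF₂, hch.trans (pathIn_triFacesIn_of_mem_of_mem hb hF₁ hF₂ hbF₁ hbF₂)⟩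

/-- **The faces of a union of tiles over a connected coarse set are dually connected**: any two
faces of the union are joined by a chain of faces of the union, consecutive ones sharing a side
(a site of the first face is joined to a site of the second inside the union; along the way
adjacent sites share a face, and the faces at a site are chained at that site). [folklore] -/
theorem pathIn_triFacesIn_tileUnion {S' : Finset (Site 2)}
    (hconn : ∀ c ∈ S', ∀ c' ∈ S', PathIn triGraph (↑S' : Set (Site 2)) c c')
    {F F' : HexVertex} (hF : F ∈ triFacesIn (tileUnion S')) (hF' : F' ∈ triFacesIn (tileUnion S')) :
    PathIn hexGraph (↑(triFacesIn (tileUnion S')) : Set HexVertex) F F' := by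
  -- a vertex of each face
  have hne : ∀ A : HexVertex, (hexFaceVertices A).Nonempty := fun A => by
    rw [← Finset.card_pos, card_hexFaceVertices]; norm_num
  obtain ⟨u, hu⟩ := hne F
  obtain ⟨u', hu'⟩ := hne F'
  have huG : u ∈ tileUnion S' := mem_triFacesIn.1 hF hu
  have hu'G : u' ∈ tileUnion S' := mem_triFacesIn.1 hF' hu'
  obtain ⟨-, hR⟩ := pathIn_tileUnion hconn huG hu'G
  obtain ⟨F₁, hF₁, hu'F₁, hch⟩ := pathIn_triFacesIn_along hR hF hu
  exact hch.trans (pathIn_triFacesIn_of_mem_of_mem hu'G hF₁ hF' hu'F₁ hu')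

end Literature.Probability.Percolation

end
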